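import Summits.QuantumFields.QCD.Theses.HeatSlicedQuarks
import Summits.QuantumFields.QCD.Theorems.SpectralDefectExtinctionTipNoBindingStubPositivity
import Summits.QuantumFields.QCD.Theorems.SpectralDefectExtinctionTipNoBindingStubSobolevSup
import Summits.QuantumFields.QCD.Theorems.SpectralDefectExtinctionTipNoBindingStubGreenBound
import Summits.QuantumFields.QCD.Theorems.SpectralDefectExtinctionTipNoBindingStubDiamagnetic
import Literature.MathematicalPhysics.QuantumLattice.DuhamelTwoPoint
import Literature.MathematicalPhysics.QuantumLattice.OverlapLocality

/-!
# `UniformLocalSpectralBound` — the U-uniform on-diagonal bound `C (t^{-1/2} + L^{-2})` for the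
# Wilson-fermion heat kernel (item stmt-QuantumFields-8876, route HeatSlicedQuarks, support)

**Statement (as filed).**  There is an absolute `C` such that for every torus side `L`, every `SU(3)`
link field `U` on `(ℤ/L)⁴`, every bare mass `m ∈ [0, 1]`, every `t ≥ 1` and every site `x`, all
colour–spin entries of the on-diagonal heat kernel of `H_U = D_W(U,m,1)ᴴ D_W(U,m,1)` obey
`|e^{-tH_U}((x,a,α),(x,b,β))| ≤ C (t^{-1/2} + L^{-2})` ("worst case is the Banks–Casher rate").
We prove it with `C = 4·max(K₀,0) + 2 ≤ 18`, `K₀` the four-torus Green constant of `stub_greenBound`.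

**Proof (self-improving spectral-sum argument, no Laplace transform needed).**
* `e^{-tH} = V diag(e^{-tλ}) V⋆`, `λ ≥ 0` (`Matrix.IsHermitian.gibbsWeight_eq`); an entry `(ξ, ξ')` is
  at most the mean of the diagonal spectral sums `S_ξ(t) = Σ_k e^{-tλ_k} |V_{ξk}|²`.
* Pointwise (Nash-type) bound (`site_mass_le`): for EVERY spinor `ψ` and site `x`,
  `Σ_{a,α}|ψ(x,a,α)|² ≤ (2/L⁴)‖ψ‖² + 4K ‖ψ‖ ‖D_Wψ‖` — torus Sobolev sup bound for `f = |ψ|`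
  (`stub_sobolevSup`, `K_L ≤ K₀` by `stub_greenBound`), Kato `E(|ψ|) ≤ K_U(ψ)` (`stub_diamagnetic`),
  accretivity `K_U(ψ) = 2 Re⟨ψ, D_W(U,0,1)ψ⟩ ≤ 2 Re⟨ψ, D_W(U,m,1)ψ⟩` for `m ≥ 0` (`stub_positivity` and
  the mass shift), Cauchy–Schwarz.
* Abstract decay (`spectral_sum_le_of_pointwise`): testing the pointwise bound on `ψ = e^{-tH}δ_ξ` gives
  `S² = |ψ(ξ)|²`, `‖ψ‖² = S(2t) ≤ S(t)`, `‖Dψ‖² = Σ λ e^{-2tλ}|V_{ξk}|² ≤ S(t)/t` (`u e^{-u} ≤ 1`), hence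
  `S_ξ(t) ≤ 2/L⁴ + 4K/√t ≤ C (t^{-1/2} + L^{-2})`.

All four analytic inputs are PROVED tree theorems (landed stubs of crux `TipNoBinding`, route
SpectralDefectExtinction, `Theorems/SpectralDefectExtinctionTipNoBindingStub*.lean`); the spectral
calculus is Mathlib's via the tree's `DuhamelTwoPoint` toolkit.  No definitions, no named facts:
unconditional.  References: Davies 1989 §2.4 (Nash-type arguments); Kato/accretivity is folklore.
-/

namespace Summit.QuantumFields.QCD.Theorems.HeatSlicedQuarks

open Literature.MathematicalPhysics Literature.MathematicalPhysics.QuantumLattice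
  Literature.MathematicalPhysics.QuantumFieldTheory Literature.Probability.LatticeModels
open Matrix
open scoped ComplexOrder
open Summit.QuantumFields.QCD.Cruxes.TipNoBinding.PositivityNoLeakSpread

/-! ## Small `ℓ²` helpers -/

section Helpers

variable {n : Type*} [Fintype n]

/-- `Σ_i ‖v i‖² = Re⟨v, v⟩` for a complex vector `v`. -/
theorem sum_norm_sq_eq_re_star_dotProduct (v : n → ℂ) :
    ∑ i, ‖v i‖ ^ 2 = (star v ⬝ᵥ v).re := by
  rw [dotProduct, Complex.re_sum]
  refine Finset.sum_congr rfl fun i _ => ?_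
  rw [Pi.star_apply, Complex.star_def, ← Complex.normSq_eq_conj_mul_self, Complex.ofReal_re,
    Complex.normSq_eq_norm_sq]

/-- `Σ_i ‖(D v) i‖² = Re⟨v, Dᴴ D v⟩`. -/
theorem sum_norm_sq_mulVec_eq_re (D : Matrix n n ℂ) (v : n → ℂ) :
    ∑ i, ‖(D *ᵥ v) i‖ ^ 2 = (star v ⬝ᵥ ((Dᴴ * D) *ᵥ v)).re := by
  rw [sum_norm_sq_eq_re_star_dotProduct, star_mulVec, ← dotProduct_mulVec, mulVec_mulVec]

/-- An isometry `A` (`Aᴴ A = 1`) preserves `Σ_i ‖v i‖²`. -/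
theorem sum_norm_sq_mulVec_of_isometry [DecidableEq n] (A : Matrix n n ℂ) (hA : Aᴴ * A = 1)
    (v : n → ℂ) : ∑ i, ‖(A *ᵥ v) i‖ ^ 2 = ∑ i, ‖v i‖ ^ 2 := by
  rw [sum_norm_sq_mulVec_eq_re, hA, one_mulVec, ← sum_norm_sq_eq_re_star_dotProduct]

/-- Discrete Cauchy–Schwarz: `‖⟨v, w⟩‖ ≤ ‖v‖ ‖w‖` in `ℓ²(n, ℂ)`. -/
theorem norm_star_dotProduct_le (v w : n → ℂ) :
    ‖star v ⬝ᵥ w‖ ≤ Real.sqrt (∑ i, ‖v i‖ ^ 2) * Real.sqrt (∑ i, ‖w i‖ ^ 2) := by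
  calc ‖star v ⬝ᵥ w‖ = ‖∑ i, star (v i) * w i‖ := rfl
    _ ≤ ∑ i, ‖star (v i) * w i‖ := norm_sum_le _ _
    _ = ∑ i, ‖v i‖ * ‖w i‖ := Finset.sum_congr rfl fun i _ => by rw [norm_mul, norm_star]
    _ ≤ Real.sqrt (∑ i, ‖v i‖ ^ 2) * Real.sqrt (∑ i, ‖w i‖ ^ 2) :=
        Real.sum_mul_le_sqrt_mul_sqrt _ _ _

/-- `Re (z̄ · (r z)) = r ‖z‖²` for real `r`. -/
theorem re_star_mul_ofReal_mul (z : ℂ) (r : ℝ) : (star z * ((r : ℂ) * z)).re = r * ‖z‖ ^ 2 := by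
  rw [mul_left_comm, Complex.star_def, ← Complex.normSq_eq_conj_mul_self, Complex.normSq_eq_norm_sq,
    ← Complex.ofReal_mul, Complex.ofReal_re]

end Helpers

/-! ## Accretivity with a mass, and the pointwise bound for Wilson fermions -/

section Wilson

variable {L : ℕ} [NeZero L]

omit [NeZero L] in
/-- **Mass shift**: `D_W(U,m,1) = D_W(U,0,1) + m·1` (both sides are `(m+4)·1 − Σ_μ W_μ`,
`wilsonDirac_eq_sub_sum_wilsonHop`). -/
theorem wilsonDirac_eq_wilsonDirac_zero_add_smul
    (U : GaugeConfig 4 L ↥(Matrix.specialUnitaryGroup (Fin 3) ℂ)) (m : ℝ) :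
    wilsonDirac (fundamentalRep (Fin 3)) U m 1 =
      wilsonDirac (fundamentalRep (Fin 3)) U 0 1 +
        (m : ℂ) • (1 : Matrix (TorusSite 4 L × Fin 3 × Fin 4) (TorusSite 4 L × Fin 3 × Fin 4) ℂ) := by
  have hρ : ∀ g, fundamentalRep (Fin 3) g ∈ Matrix.unitaryGroup (Fin 3) ℂ :=
    fundamentalRep_mem_unitaryGroup
  rw [wilsonDirac_eq_sub_sum_wilsonHop (fundamentalRep (Fin 3)) hρ U m,
    wilsonDirac_eq_sub_sum_wilsonHop (fundamentalRep (Fin 3)) hρ U 0]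
  have h : ((m + 4 : ℝ) : ℂ) = ((0 + 4 : ℝ) : ℂ) + (m : ℂ) := by push_cast; ring
  rw [h, add_smul]
  abel

/-- **Accretivity with a mass** (`stub_positivity` plus the mass shift): for `m ≥ 0`,
`Σ_{x,μ,a,α} |Σ_b U(x,μ)_{ab} ψ(x+μ̂)_{bα} − ψ(x)_{aα}|² ≤ 2 Re⟨ψ, D_W(U,m,1)ψ⟩`. -/
theorem covariant_dirichlet_le_two_mul_re
    (U : GaugeConfig 4 L ↥(Matrix.specialUnitaryGroup (Fin 3) ℂ)) {m : ℝ} (hm : 0 ≤ m)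
    (ψ : TorusSite 4 L × Fin 3 × Fin 4 → ℂ) :
    ∑ x, ∑ μ, ∑ a, ∑ α, ‖(∑ b, (U (x, μ) : Matrix (Fin 3) (Fin 3) ℂ) a b *
        ψ (QuantumFieldTheory.Site.shift x μ, b, α)) - ψ (x, a, α)‖ ^ 2 ≤
      2 * (star ψ ⬝ᵥ (wilsonDirac (fundamentalRep (Fin 3)) U m 1 *ᵥ ψ)).re := by
  have h0 := stub_positivity L U ψ
  have hm' : (star ψ ⬝ᵥ (wilsonDirac (fundamentalRep (Fin 3)) U m 1 *ᵥ ψ)).re =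
      (star ψ ⬝ᵥ (wilsonDirac (fundamentalRep (Fin 3)) U 0 1 *ᵥ ψ)).re + m * ∑ i, ‖ψ i‖ ^ 2 := by
    rw [wilsonDirac_eq_wilsonDirac_zero_add_smul, add_mulVec, dotProduct_add, Complex.add_re,
      smul_mulVec, one_mulVec, dotProduct_smul, smul_eq_mul, Complex.re_ofReal_mul,
      ← sum_norm_sq_eq_re_star_dotProduct]
  have hP : 0 ≤ ∑ i, ‖ψ i‖ ^ 2 := Finset.sum_nonneg fun _ _ => by positivity
  rw [hm', h0]
  nlinarith

/-- **Pointwise bound** (Sobolev sup bound on `(ℤ/L)⁴` ∘ Kato ∘ accretivity ∘ Cauchy–Schwarz): if the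
four-torus Green constant `K_L` is at most `K`, then for every `SU(3)` field `U`, every `m ≥ 0`,
every spinor `ψ` and every site `x`,
`Σ_{a,α} |ψ(x,a,α)|² ≤ (2/L⁴)‖ψ‖² + 4K ‖ψ‖ ‖D_W(U,m,1)ψ‖`. -/
theorem site_mass_le (K : ℝ)
    (hK : (1 / (L : ℝ) ^ 4) * ∑ k ∈ (Finset.univ : Finset (TorusSite 4 L)).filter (· ≠ 0),
          1 / (∑ μ, 4 * Real.sin (Real.pi * ((k μ).val : ℝ) / L) ^ 2) ≤ K)
    (U : GaugeConfig 4 L ↥(Matrix.specialUnitaryGroup (Fin 3) ℂ)) {m : ℝ} (hm : 0 ≤ m)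
    (ψ : TorusSite 4 L × Fin 3 × Fin 4 → ℂ) (x : TorusSite 4 L) :
    ∑ a, ∑ α, ‖ψ (x, a, α)‖ ^ 2 ≤
      (2 / (L : ℝ) ^ 4) * ∑ i, ‖ψ i‖ ^ 2 +
        4 * K * Real.sqrt (∑ i, ‖ψ i‖ ^ 2) *
          Real.sqrt (∑ i, ‖(wilsonDirac (fundamentalRep (Fin 3)) U m 1 *ᵥ ψ) i‖ ^ 2) := by
  -- the site modulus `f = |ψ|`
  set f : TorusSite 4 L → ℝ := fun y => Real.sqrt (∑ a, ∑ α, ‖ψ (y, a, α)‖ ^ 2) with hfdef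
  have hsq0 : ∀ y, 0 ≤ ∑ a, ∑ α, ‖ψ (y, a, α)‖ ^ 2 := fun y =>
    Finset.sum_nonneg fun _ _ => Finset.sum_nonneg fun _ _ => by positivity
  have hfy : ∀ y, f y ^ 2 = ∑ a, ∑ α, ‖ψ (y, a, α)‖ ^ 2 := fun y => Real.sq_sqrt (hsq0 y)
  have hsumf : ∑ y, f y ^ 2 = ∑ i, ‖ψ i‖ ^ 2 := by
    simp only [hfy, Fintype.sum_prod_type]
  -- Kato: the Dirichlet energy of `|ψ|` is at most the covariant one
  have hE : ∑ y, ∑ μ, (f (QuantumFieldTheory.Site.shift y μ) - f y) ^ 2 ≤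
      ∑ y, ∑ μ, ∑ a, ∑ α, ‖(∑ b, (U (y, μ) : Matrix (Fin 3) (Fin 3) ℂ) a b *
          ψ (QuantumFieldTheory.Site.shift y μ, b, α)) - ψ (y, a, α)‖ ^ 2 :=
    Finset.sum_le_sum fun y _ => Finset.sum_le_sum fun μ _ => stub_diamagnetic L U ψ y μ
  -- accretivity and Cauchy–Schwarz
  have hA := covariant_dirichlet_le_two_mul_re U hm ψ
  have hCS : (star ψ ⬝ᵥ (wilsonDirac (fundamentalRep (Fin 3)) U m 1 *ᵥ ψ)).re ≤
      Real.sqrt (∑ i, ‖ψ i‖ ^ 2) *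
        Real.sqrt (∑ i, ‖(wilsonDirac (fundamentalRep (Fin 3)) U m 1 *ᵥ ψ) i‖ ^ 2) :=
    (Complex.re_le_norm _).trans (norm_star_dotProduct_le _ _)
  -- the Sobolev sup bound at `x`
  have hS := stub_sobolevSup L f x
  rw [hfy, hsumf] at hS
  -- the Green constant of this torus
  set G : ℝ := (1 / (L : ℝ) ^ 4) * ∑ k ∈ (Finset.univ : Finset (TorusSite 4 L)).filter (· ≠ 0),
      1 / (∑ μ, 4 * Real.sin (Real.pi * ((k μ).val : ℝ) / L) ^ 2) with hGdef
  have hD0 : 0 ≤ ∑ y, ∑ μ, (f (QuantumFieldTheory.Site.shift y μ) - f y) ^ 2 :=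
    Finset.sum_nonneg fun _ _ => Finset.sum_nonneg fun _ _ => sq_nonneg _
  have h1 : G * ∑ y, ∑ μ, (f (QuantumFieldTheory.Site.shift y μ) - f y) ^ 2 ≤
      K * ∑ y, ∑ μ, (f (QuantumFieldTheory.Site.shift y μ) - f y) ^ 2 :=
    mul_le_mul_of_nonneg_right hK hD0
  have hG0 : 0 ≤ G := by
    rw [hGdef]
    refine mul_nonneg (by positivity) (Finset.sum_nonneg fun k _ => ?_)
    exact div_nonneg zero_le_one (Finset.sum_nonneg fun μ _ => by positivity)
  have hK0' : 0 ≤ K := hG0.trans hK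
  have h2 : K * ∑ y, ∑ μ, (f (QuantumFieldTheory.Site.shift y μ) - f y) ^ 2 ≤
      K * (2 * (Real.sqrt (∑ i, ‖ψ i‖ ^ 2) *
        Real.sqrt (∑ i, ‖(wilsonDirac (fundamentalRep (Fin 3)) U m 1 *ᵥ ψ) i‖ ^ 2))) :=
    mul_le_mul_of_nonneg_left (hE.trans (hA.trans (by linarith))) hK0'
  linarith

end Wilson


/-! ## Spectral sums: abstract on-diagonal decay from a pointwise bound -/

section Spectral

variable {n : Type*} [Fintype n] [DecidableEq n]

/-- Entries of `V diag(u) V⋆`: `(V diag(u) V⋆)_{ij} = Σ_k V_{ik} u_k conj(V_{jk})`. -/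
theorem conj_diagonal_apply (V : Matrix n n ℂ) (u : n → ℂ) (i j : n) :
    (V * diagonal u * star V) i j = ∑ k, V i k * u k * star (V j k) := by
  rw [mul_apply]
  refine Finset.sum_congr rfl fun k _ => ?_
  rw [mul_diagonal, star_apply]

/-- **Off-diagonal entries are dominated by diagonal spectral sums**: for real `u ≥ 0`,
`‖(V diag(u) V⋆)_{ij}‖ ≤ ½ (Σ_k u_k ‖V_{ik}‖² + Σ_k u_k ‖V_{jk}‖²)` (termwise `ab ≤ (a² + b²)/2`). -/
theorem norm_conj_diagonal_apply_le (V : Matrix n n ℂ) (u : n → ℝ) (hu : ∀ k, 0 ≤ u k) (i j : n) :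
    ‖(V * diagonal (fun k => (u k : ℂ)) * star V) i j‖ ≤
      (∑ k, u k * ‖V i k‖ ^ 2 + ∑ k, u k * ‖V j k‖ ^ 2) / 2 := by
  rw [conj_diagonal_apply]
  calc ‖∑ k, V i k * (u k : ℂ) * star (V j k)‖
      ≤ ∑ k, ‖V i k * (u k : ℂ) * star (V j k)‖ := norm_sum_le _ _
    _ = ∑ k, u k * (‖V i k‖ * ‖V j k‖) := Finset.sum_congr rfl fun k _ => by
        rw [norm_mul, norm_mul, norm_star, Complex.norm_real, Real.norm_of_nonneg (hu k)]
        ring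
    _ ≤ ∑ k, u k * ((‖V i k‖ ^ 2 + ‖V j k‖ ^ 2) / 2) := Finset.sum_le_sum fun k _ => by
        refine mul_le_mul_of_nonneg_left ?_ (hu k)
        nlinarith [sq_nonneg (‖V i k‖ - ‖V j k‖)]
    _ = (∑ k, u k * ‖V i k‖ ^ 2 + ∑ k, u k * ‖V j k‖ ^ 2) / 2 := by
        rw [← Finset.sum_add_distrib, Finset.sum_div]
        refine Finset.sum_congr rfl fun k _ => ?_
        ring

/-- `u e^{-u} ≤ 1`, in the form `t λ e^{-tλ} ≤ 1`. -/
theorem mul_exp_neg_le_one (u : ℝ) : u * Real.exp (-u) ≤ 1 := by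
  have h1 := Real.add_one_le_exp u
  have h2 : Real.exp (-u) * Real.exp u = 1 := by rw [← Real.exp_add]; simp
  nlinarith [Real.exp_pos (-u), Real.exp_pos u]

/-- **Abstract on-diagonal decay from a pointwise bound.**  Let `D` be a complex square matrix,
`H = Dᴴ D = V diag(λ) V⋆` its (positive) spectral decomposition, `t > 0` and `ξ` an index.  If
every vector `ψ` obeys the Nash-type pointwise bound `|ψ(ξ)|² ≤ A ‖ψ‖² + B ‖ψ‖ ‖Dψ‖` with
`A, B ≥ 0`, then the spectral sum `S_ξ(t) = Σ_k e^{-tλ_k} |V_{ξk}|² = (e^{-tH})_{ξξ}` satisfies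
`S_ξ(t) ≤ A + B/√t`.
Proof: test the bound on `ψ = e^{-tH} δ_ξ = V c`, `c_k = e^{-tλ_k} conj V_{ξk}`: `ψ(ξ) = S_ξ(t)`,
`‖ψ‖² = S_ξ(2t) ≤ S_ξ(t)` and `‖Dψ‖² = Σ_k λ_k e^{-2tλ_k}|V_{ξk}|² ≤ S_ξ(t)/t` (`u e^{-u} ≤ 1`,
`λ_k ≥ 0`), so `S² ≤ S (A + B/√t)`. -/
theorem spectral_sum_le_of_pointwise (D : Matrix n n ℂ) {t : ℝ} (ht : 0 < t) (ξ : n) {A B : ℝ}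
    (hA : 0 ≤ A) (hB : 0 ≤ B)
    (hpt : ∀ ψ : n → ℂ, ‖ψ ξ‖ ^ 2 ≤ A * ∑ i, ‖ψ i‖ ^ 2 +
      B * Real.sqrt (∑ i, ‖ψ i‖ ^ 2) * Real.sqrt (∑ i, ‖(D *ᵥ ψ) i‖ ^ 2)) :
    ∑ k, Real.exp (-(t * (isHermitian_conjTranspose_mul_self D).eigenvalues k)) *
        ‖((isHermitian_conjTranspose_mul_self D).eigenvectorUnitary : Matrix n n ℂ) ξ k‖ ^ 2 ≤
      A + B / Real.sqrt t := by
  have hH : (Dᴴ * D).IsHermitian := isHermitian_conjTranspose_mul_self D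
  have hP : (Dᴴ * D).PosSemidef := posSemidef_conjTranspose_mul_self D
  set lam : n → ℝ := hH.eigenvalues with hlam
  set V : Matrix n n ℂ := (hH.eigenvectorUnitary : Matrix n n ℂ) with hVdef
  have hVu : V ∈ unitary (Matrix n n ℂ) := hH.eigenvectorUnitary.prop
  have hVV : star V * V = 1 := Unitary.star_mul_self_of_mem hVu
  have hlam0 : ∀ k, 0 ≤ lam k := fun k => hP.eigenvalues_nonneg k
  -- the weights
  set e : n → ℝ := fun k => Real.exp (-(t * lam k)) with he
  have he0 : ∀ k, 0 < e k := fun k => Real.exp_pos _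
  have he1 : ∀ k, e k ≤ 1 := fun k => by
    rw [he]
    exact Real.exp_le_one_iff.mpr (by nlinarith [hlam0 k, ht])
  set w : n → ℝ := fun k => ‖V ξ k‖ ^ 2 with hw
  have hw0 : ∀ k, 0 ≤ w k := fun k => by positivity
  set S : ℝ := ∑ k, e k * w k with hS
  have hS0 : 0 ≤ S := Finset.sum_nonneg fun k _ => mul_nonneg (he0 k).le (hw0 k)
  -- the test vector `ψ = V c`
  set c : n → ℂ := fun k => (e k : ℂ) * star (V ξ k) with hc
  set ψ : n → ℂ := V *ᵥ c with hψ
  have hnc : ∀ k, ‖c k‖ ^ 2 = e k ^ 2 * w k := fun k => by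
    rw [hc]
    simp only
    rw [norm_mul, norm_star, Complex.norm_real, Real.norm_of_nonneg (he0 k).le, mul_pow]
  -- `ψ ξ = S`
  have hψξ : ψ ξ = (S : ℂ) := by
    rw [hψ, mulVec, dotProduct, hS, Complex.ofReal_sum]
    refine Finset.sum_congr rfl fun k _ => ?_
    rw [hc, hw]
    simp only
    rw [mul_left_comm, mul_star_eq_normSq_cast]
    push_cast
    ring
  -- `‖ψ‖² = Σ e² w ≤ S`
  have hP1 : ∑ i, ‖ψ i‖ ^ 2 = ∑ k, e k ^ 2 * w k := by
    rw [hψ, sum_norm_sq_mulVec_of_isometry V (by rwa [← star_eq_conjTranspose]) c]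
    exact Finset.sum_congr rfl fun k _ => hnc k
  have hP2 : ∑ k, e k ^ 2 * w k ≤ S := by
    refine Finset.sum_le_sum fun k _ => ?_
    have hew : 0 ≤ e k * w k := mul_nonneg (he0 k).le (hw0 k)
    calc e k ^ 2 * w k = e k * (e k * w k) := by ring
      _ ≤ 1 * (e k * w k) := mul_le_mul_of_nonneg_right (he1 k) hew
      _ = e k * w k := one_mul _
  -- `‖Dψ‖² = Σ λ e² w ≤ S / t`
  have hHV : Dᴴ * D * V = V * diagonal (fun k => (lam k : ℂ)) := by
    conv_lhs => rw [hH.eq_conj_diagonal]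
    rw [Matrix.mul_assoc, ← hVdef, hVV, Matrix.mul_one]
  have hQ1 : ∑ i, ‖(D *ᵥ ψ) i‖ ^ 2 = ∑ k, lam k * (e k ^ 2 * w k) := by
    rw [sum_norm_sq_mulVec_eq_re, hψ, mulVec_mulVec, hHV, ← mulVec_mulVec, star_mulVec,
      ← dotProduct_mulVec, mulVec_mulVec, ← star_eq_conjTranspose, hVV, one_mulVec, dotProduct,
      Complex.re_sum]
    refine Finset.sum_congr rfl fun k _ => ?_
    rw [mulVec_diagonal, Pi.star_apply, re_star_mul_ofReal_mul, hnc]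
  have hQ2 : ∑ k, lam k * (e k ^ 2 * w k) ≤ S / t := by
    rw [hS, Finset.sum_div]
    refine Finset.sum_le_sum fun k _ => ?_
    have hk : t * lam k * e k ≤ 1 := by
      have := mul_exp_neg_le_one (t * lam k)
      rwa [he]
    rw [le_div_iff₀ ht]
    have hew : 0 ≤ e k * w k := mul_nonneg (he0 k).le (hw0 k)
    calc lam k * (e k ^ 2 * w k) * t = (t * lam k * e k) * (e k * w k) := by ring
      _ ≤ 1 * (e k * w k) := mul_le_mul_of_nonneg_right hk hew
      _ = e k * w k := one_mul _
  -- the pointwise bound tested on `ψ`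
  have hmain := hpt ψ
  rw [hψξ, Complex.norm_real, Real.norm_of_nonneg hS0, hP1, hQ1] at hmain
  have hsq1 : Real.sqrt (∑ k, e k ^ 2 * w k) ≤ Real.sqrt S := Real.sqrt_le_sqrt hP2
  have hsq2 : Real.sqrt (∑ k, lam k * (e k ^ 2 * w k)) ≤ Real.sqrt S / Real.sqrt t := by
    rw [← Real.sqrt_div hS0]
    exact Real.sqrt_le_sqrt hQ2
  have ht' : 0 < Real.sqrt t := Real.sqrt_pos.mpr ht
  have hSS : Real.sqrt S * (Real.sqrt S / Real.sqrt t) = S / Real.sqrt t := by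
    rw [mul_div_assoc', Real.mul_self_sqrt hS0]
  have hbound : S ^ 2 ≤ S * (A + B / Real.sqrt t) := by
    calc S ^ 2 ≤ A * ∑ k, e k ^ 2 * w k + B * Real.sqrt (∑ k, e k ^ 2 * w k) *
          Real.sqrt (∑ k, lam k * (e k ^ 2 * w k)) := hmain
      _ ≤ A * S + B * Real.sqrt S * (Real.sqrt S / Real.sqrt t) := by
          gcongr
      _ = S * (A + B / Real.sqrt t) := by
          rw [mul_assoc, hSS]
          ring
  -- conclude
  by_contra hlt
  push Not at hlt
  have hpos : 0 < S := lt_of_le_of_lt (by positivity) hlt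
  have : S * (A + B / Real.sqrt t) < S * S := mul_lt_mul_of_pos_left hlt hpos
  nlinarith

end Spectral

/-! ## The item -/

/-- **`UniformLocalSpectralBound`** (item stmt-QuantumFields-8876 of route HeatSlicedQuarks, as stated):
there is an absolute `C` (here `C = 4·max(K₀,0) + 2 ≤ 18`, `K₀` the four-torus Green constant bound of
`stub_greenBound`) such that for every torus side `L`, every `SU(3)` field `U`, every `m ∈ [0,1]`,
every `t ≥ 1` and every site `x`, all colour–spin entries of the on-diagonal heat kernel of
`H_U = D_W(U,m,1)ᴴ D_W(U,m,1)` obey `|e^{-tH_U}((x,a,α),(x,b,β))| ≤ C (t^{-1/2} + L^{-2})`.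
Proof: `e^{-tH_U} = V diag(e^{-tλ}) V⋆` (`Matrix.IsHermitian.gibbsWeight_eq`); the entry is at most
the mean of the two diagonal spectral sums (`norm_conj_diagonal_apply_le`); each diagonal spectral sum is
`≤ 2/L⁴ + 4K/√t` by `spectral_sum_le_of_pointwise` fed with the pointwise bound `site_mass_le`
(torus Sobolev sup bound `stub_sobolevSup` + `stub_greenBound`, Kato `stub_diamagnetic`, accretivity
`stub_positivity` with the mass shift, Cauchy–Schwarz). -/
theorem UniformLocalSpectralBound_proof :
    Summit.QuantumFields.QCD.Theses.HeatSlicedQuarks.UniformLocalSpectralBound := by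
  obtain ⟨K₀, hK₀⟩ := stub_greenBound
  refine ⟨4 * max K₀ 0 + 2, ?_⟩
  intro L _ U m hm t ht x a b α β
  set K : ℝ := max K₀ 0 with hKdef
  have hK0 : 0 ≤ K := le_max_right _ _
  have hKL : (1 / (L : ℝ) ^ 4) * ∑ k ∈ (Finset.univ : Finset (TorusSite 4 L)).filter (· ≠ 0),
      1 / (∑ μ, 4 * Real.sin (Real.pi * ((k μ).val : ℝ) / L) ^ 2) ≤ K :=
    (hK₀ L).trans (le_max_left _ _)
  set D := wilsonDirac (fundamentalRep (Fin 3)) U m 1 with hDdef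
  have ht0 : 0 < t := lt_of_lt_of_le zero_lt_one ht
  have hL1 : (1 : ℝ) ≤ L := by exact_mod_cast Nat.one_le_iff_ne_zero.mpr (NeZero.ne L)
  have hL0 : (0 : ℝ) < L := lt_of_lt_of_le zero_lt_one hL1
  -- the pointwise bound at every index
  have hpt : ∀ (ξ : TorusSite 4 L × Fin 3 × Fin 4) (ψ : TorusSite 4 L × Fin 3 × Fin 4 → ℂ),
      ‖ψ ξ‖ ^ 2 ≤ (2 / (L : ℝ) ^ 4) * ∑ i, ‖ψ i‖ ^ 2 +
        (4 * K) * Real.sqrt (∑ i, ‖ψ i‖ ^ 2) * Real.sqrt (∑ i, ‖(D *ᵥ ψ) i‖ ^ 2) := by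
    rintro ⟨y, a', α'⟩ ψ
    have h := site_mass_le K hKL U hm.1 ψ y
    have h1 : ‖ψ (y, a', α')‖ ^ 2 ≤ ∑ α, ‖ψ (y, a', α)‖ ^ 2 :=
      Finset.single_le_sum (f := fun α => ‖ψ (y, a', α)‖ ^ 2) (fun _ _ => by positivity)
        (Finset.mem_univ α')
    have h2 : ∑ α, ‖ψ (y, a', α)‖ ^ 2 ≤ ∑ a, ∑ α, ‖ψ (y, a, α)‖ ^ 2 :=
      Finset.single_le_sum (f := fun a => ∑ α, ‖ψ (y, a, α)‖ ^ 2)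
        (fun _ _ => Finset.sum_nonneg fun _ _ => by positivity) (Finset.mem_univ a')
    exact h1.trans (h2.trans h)
  -- spectral data of `H = Dᴴ D`
  have hH : (Dᴴ * D).IsHermitian := isHermitian_conjTranspose_mul_self D
  set V : Matrix (TorusSite 4 L × Fin 3 × Fin 4) (TorusSite 4 L × Fin 3 × Fin 4) ℂ :=
    (hH.eigenvectorUnitary : Matrix (TorusSite 4 L × Fin 3 × Fin 4) (TorusSite 4 L × Fin 3 × Fin 4) ℂ)
    with hVdef
  set lam := hH.eigenvalues with hlam
  have hSle : ∀ ξ : TorusSite 4 L × Fin 3 × Fin 4,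
      ∑ k, Real.exp (-(t * lam k)) * ‖V ξ k‖ ^ 2 ≤ 2 / (L : ℝ) ^ 4 + 4 * K / Real.sqrt t :=
    fun ξ => spectral_sum_le_of_pointwise D ht0 ξ (by positivity) (by positivity) (hpt ξ)
  -- the heat kernel in the eigenbasis
  have hexp : NormedSpace.exp (-(t : ℂ) • (Dᴴ * D)) =
      V * diagonal (fun k => (Real.exp (-(t * lam k)) : ℂ)) * star V := hH.gibbsWeight_eq t
  rw [hexp]
  have hent := norm_conj_diagonal_apply_le V (fun k => Real.exp (-(t * lam k)))
    (fun k => (Real.exp_pos _).le) (x, a, α) (x, b, β)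
  have hdiag : (∑ k, Real.exp (-(t * lam k)) * ‖V (x, a, α) k‖ ^ 2 +
      ∑ k, Real.exp (-(t * lam k)) * ‖V (x, b, β) k‖ ^ 2) / 2 ≤
        2 / (L : ℝ) ^ 4 + 4 * K / Real.sqrt t := by
    linarith [hSle (x, a, α), hSle (x, b, β)]
  -- bookkeeping: `2/L⁴ + 4K/√t ≤ (4K + 2)(1/√t + 1/L²)`
  have ht' : 0 < Real.sqrt t := Real.sqrt_pos.mpr ht0
  have hL4 : 2 / (L : ℝ) ^ 4 ≤ 2 * (1 / (L : ℝ) ^ 2) := by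
    rw [mul_one_div, div_le_div_iff₀ (by positivity) (by positivity)]
    have : (L : ℝ) ^ 2 ≤ (L : ℝ) ^ 4 := pow_le_pow_right₀ hL1 (by norm_num)
    nlinarith
  have hfin : 2 / (L : ℝ) ^ 4 + 4 * K / Real.sqrt t ≤
      (4 * max K₀ 0 + 2) * (1 / Real.sqrt t + 1 / (L : ℝ) ^ 2) := by
    rw [← hKdef]
    have h1 : 0 ≤ 1 / Real.sqrt t := by positivity
    have h2 : 0 ≤ 1 / (L : ℝ) ^ 2 := by positivity
    have h3 : 4 * K / Real.sqrt t = 4 * K * (1 / Real.sqrt t) := by ring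
    nlinarith [mul_nonneg hK0 h2, h1]
  exact hent.trans (hdiag.trans hfin)

end Summit.QuantumFields.QCD.Theorems.HeatSlicedQuarks
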